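import Literature.NumberTheory.Sieve.ChenSieveProduct
import Literature.NumberTheory.Sieve.RosserSieveTheoremOneHalfLt
import Literature.NumberTheory.Sieve.LinearSieveConstant
import Literature.NumberTheory.Sieve.ChenTwinSieveLower
import HarnessLib

/-!
# Chen's theorem, the switching term (Nathanson Thm 10.6): the sieve inputs

Topic `Literature/NumberTheory/Sieve`; a companion of `ChenTheorem.lean`, which vendors the
architecture of the printed proof of Chen's theorem `N = p + P₂` (Nathanson, *Additive Number
Theory: The Classical Bases*, GTM 164, Ch. 10) as named facts. This file PROVES the three sieve
inputs of the proof of Theorem 10.6 (the upper bound for `S(B, 𝒫, y)`, pp. 288–289 of the book):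

* `Literature.NumberTheory.Sieve.hasIwaniecDimension_shiftedPrimesDensity` — for EVEN `N` the
  Goldbach/Chen density `g(d) = 1/φ(d)` (`(d, N) = 1`), `g(d) = 0` (`(d, N) > 1`) — the tree's
  `shiftedPrimesDensity N` — satisfies Iwaniec's linear dimension condition `Ω(1, L₀)` with the
  ABSOLUTE constant `L₀ = 54 e^{54/log 2}` (uniformly in `N`; Nathanson §10.3, verification of
  (9.33)–(9.34), from Mertens' product theorem with the rate `25/log`);
* `Literature.NumberTheory.Sieve.LinearSieve.upper_explicit` — the UNIFORM linear-sieve upper bound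
  with the closed form `F(s) = 2e^γ/s` inserted: for every `L` there is `C` such that for every
  sifted sequence of dimension `Ω(1, L)`, every `x`, and all `2 ≤ z ≤ D` with `s = log D/log z ≤ 3`,
  `S(𝒜, z; x) ≤ X V(z) (2e^γ/s + C (log D)^{-1/3}) + ∑_{d < D, d ∣ P(z)} |R_d(x)|`
  (Jurkat–Richert; here from Iwaniec's Theorem 1 as PROVED in the tree,
  `Iwaniec1980_thm1_upper_of_half_lt`, and `F₁(s) = 2e^γ/s` on `(0, 3]`,
  `upperSieveFun_one_eq_holds`). This is the form of Nathanson's Thm 9.7/9.8 that the proof of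
  Thm 10.6 consumes for the sets `B^{(ℓ)}`, which vary with `N` (so that the fixed-sequence
  asymptotic forms `SieveSequence.linear_sieve_upper_holds` do not apply);
* `Literature.NumberTheory.Sieve.Chen.sieveProduct_le_mul_of_le` — the comparison of Chen's
  products `V(w) = ∏_{p < w, p ∤ N} (1 − 1/(p−1))` at two levels `2 ≤ z ≤ w` for even `N ≤ z⁸`:
  `V(w) ≤ V(z) · (log z/log w) · e^{50/log z} · (1 + 1/(z−1))⁸`, i.e. Nathanson's
  `V(y)/V(z) = (log z/log y)(1 + O(1/log N)) = 3/8 + O(1/log N)` (p. 289, from (10.3) = Thm 6.8)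
  in the one-sided explicit form needed for the upper bound.

Everything here is PROVED; no new definitions and no named facts.

## References

* M. B. Nathanson, *Additive Number Theory: The Classical Bases*, GTM 164 (1996), §10.3 and the
  proof of Thm 10.6 (pp. 288–289). [Nathanson1996]
* H. Iwaniec, *Rosser's sieve*, Acta Arith. 36 (1980), 171–202, Theorem 1. [IwaniecActaArith1980]
* G. H. Hardy, E. M. Wright, *An Introduction to the Theory of Numbers*, Thm 429 (Mertens).
  [HardyWright2008]
-/

open Finset Real

noncomputable section

namespace Literature.NumberTheory.Sieve

open PairProducts

/-! ### The explicit linear-sieve upper bound with `F(s) = 2e^γ/s` -/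

namespace LinearSieve

/-- **The linear sieve, explicit uniform upper bound** (Jurkat–Richert 1965; Iwaniec, *Rosser's
sieve*, Thm 1 for `κ = 1`, with `F(s) = 2e^γ/s` for `0 < s ≤ 3`; Nathanson Thms 9.7–9.8): for every
`L` there is `C = C(L)` such that for every sifted sequence `𝒜` whose density satisfies `Ω(1, L)`,
every `x` with `X(x) ≥ 0` and all `2 ≤ z ≤ D` with `log D/log z ≤ 3`,
`S(𝒜, z; x) ≤ X(x) V(z) (2e^γ/(log D/log z) + C (log D)^{-1/3}) + ∑_{d < D, d ∣ P(z)} |R_d(x)|`.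
[cite: IwaniecActaArith1980, Thm 1 (1.4), (1.6)] -/
theorem upper_explicit (L : ℝ) :
    ∃ C : ℝ, ∀ (A : SieveSequence), HasIwaniecDimension A.density 1 L →
      ∀ x D z : ℝ, 2 ≤ z → z ≤ D → Real.log D / Real.log z ≤ 3 → 0 ≤ A.size x →
        A.sifted x (primesProdBelow z) ≤
          A.size x * A.densityProduct (primesProdBelow z) *
              (2 * Real.exp Real.eulerMascheroniConstant / (Real.log D / Real.log z) +
                C * Real.log D ^ (-(1 / 3 : ℝ))) +
            ∑ d ∈ (Finset.range ⌈D⌉₊).filter (· ∣ primesProdBelow z), |A.remainder d x| := by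
  obtain ⟨B, hB, hC⟩ := Iwaniec1980_thm1_upper_of_half_lt (κ := 1) (by norm_num)
  obtain ⟨C, hC⟩ := hC L
  refine ⟨C, fun A hdim x D z hz hzD hs hsize => ?_⟩
  have h := hC A hdim x D z hz hzD hsize
  have hlogz : 0 < Real.log z := Real.log_pos (by linarith)
  have hlogD : 0 < Real.log D := Real.log_pos (by linarith)
  have hspos : 0 < Real.log D / Real.log z := div_pos hlogD hlogz
  -- `B.1 = F₁` on `(0, ∞)` and `F₁(s) = 2e^γ/s` on `(0, 3]`
  have hEq : B.1 (Real.log D / Real.log z) = upperSieveFun 1 (Real.log D / Real.log z) := by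
    have h1 := (hB.unique isGreatestBetaSieveData_greatestBetaSieveData_one).1 hspos
    rw [h1, upperSieveFun_one]
    rfl
  have hF : B.1 (Real.log D / Real.log z) =
      2 * Real.exp Real.eulerMascheroniConstant / (Real.log D / Real.log z) := by
    rw [hEq]
    exact upperSieveFun_one_eq_holds ⟨hspos, hs⟩
  rw [hF] at h
  exact h

end LinearSieve

/-! ### The Goldbach density `1/φ(d)·1_{(d,N)=1}` has dimension `Ω(1, L₀)` for even `N` -/

/-- For even `N` and a prime `p` the Chen/Goldbach density is `g(p) = 1/(p−1)` if `p ∤ N` and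
`g(p) = 0` if `p ∣ N`; in the first case `p ≥ 3`. [cite: Nathanson1996, §10.3] -/
theorem shiftedPrimesDensity_prime_of_even {N p : ℕ} (hN : Even N) (hp : p.Prime) :
    (¬p ∣ N → shiftedPrimesDensity N p = ((p : ℝ) - 1)⁻¹ ∧ 3 ≤ p) ∧
      (p ∣ N → shiftedPrimesDensity N p = 0) := by
  constructor
  · intro hpN
    have hp2 : p ≠ 2 := by
      rintro rfl
      exact hpN (even_iff_two_dvd.mp hN)
    have hp3 : 3 ≤ p := lt_of_le_of_ne hp.two_le (Ne.symm hp2)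
    have hcop : p.Coprime N := (Nat.Prime.coprime_iff_not_dvd hp).mpr hpN
    refine ⟨?_, hp3⟩
    rw [shiftedPrimesDensity_apply, if_pos ⟨hcop, hp.ne_zero⟩, Nat.totient_prime hp,
      Nat.cast_sub hp.one_le, Nat.cast_one]
  · intro hpN
    rw [shiftedPrimesDensity_apply, if_neg]
    rintro ⟨hcop, -⟩
    exact (Nat.Prime.coprime_iff_not_dvd hp).mp hcop hpN

/-- For even `N` and every prime `p`: `0 ≤ g(p) ≤ 1/2 < 1` for the Chen/Goldbach density
(Nathanson (9.33) in §10.3: `0 < 1/(p−1) < 1` since only odd primes occur).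
[cite: Nathanson1996, §10.3 (9.33)] -/
theorem shiftedPrimesDensity_prime_mem_Icc {N p : ℕ} (hN : Even N) (hp : p.Prime) :
    0 ≤ shiftedPrimesDensity N p ∧ shiftedPrimesDensity N p ≤ 1 / 2 := by
  obtain ⟨h1, h2⟩ := shiftedPrimesDensity_prime_of_even hN hp
  by_cases hpN : p ∣ N
  · rw [h2 hpN]; norm_num
  · obtain ⟨h, hp3⟩ := h1 hpN
    have hp3' : (3 : ℝ) ≤ p := by exact_mod_cast hp3
    rw [h]
    constructor
    · exact inv_nonneg.mpr (by linarith)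
    · rw [inv_eq_one_div, div_le_div_iff₀ (by linarith) (by norm_num)]
      linarith

/-- Pointwise comparison of the sieve factors: for even `N` and a prime `p ≥ 3` in the sifting
range, `(1 − g(p))⁻¹ ≤ (1 − 1/p)⁻¹ (1 + 1/(p(p−2)))` (with equality when `p ∤ N`:
`(p−1)/(p−2) = p/(p−1) · (p−1)²/(p(p−2))`), and `(1 − g(2))⁻¹ = 1`. [cite: Nathanson1996, §10.3] -/
theorem inv_one_sub_shiftedPrimesDensity_le {N p : ℕ} (hN : Even N) (hp : p.Prime) (hp3 : 3 ≤ p) :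
    (1 - shiftedPrimesDensity N p)⁻¹ ≤
      (1 - (p : ℝ)⁻¹)⁻¹ * (1 + 1 / ((p : ℝ) * ((p : ℝ) - 2))) := by
  have hp3' : (3 : ℝ) ≤ p := by exact_mod_cast hp3
  have hp0 : (0 : ℝ) < p := by linarith
  have hrhs : (1 - (p : ℝ)⁻¹)⁻¹ * (1 + 1 / ((p : ℝ) * ((p : ℝ) - 2))) =
      ((p : ℝ) - 1) / ((p : ℝ) - 2) := by
    have h1 : (p : ℝ) - 1 ≠ 0 := by linarith
    have h2 : (p : ℝ) - 2 ≠ 0 := by linarith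
    field_simp
    ring
  rw [hrhs]
  obtain ⟨h1, h2⟩ := shiftedPrimesDensity_prime_of_even hN hp
  by_cases hpN : p ∣ N
  · rw [h2 hpN, sub_zero, inv_one]
    rw [le_div_iff₀ (by linarith)]
    linarith
  · rw [(h1 hpN).1]
    have h1' : (p : ℝ) - 1 ≠ 0 := by linarith
    have h2' : (p : ℝ) - 2 ≠ 0 := by linarith
    rw [show (1 : ℝ) - ((p : ℝ) - 1)⁻¹ = ((p : ℝ) - 2) / ((p : ℝ) - 1) by field_simp; ring,
      inv_div]

/-- The sieve factors over the primes `p ≥ max(w, 3)` below `z`: for even `N` and `w ≤ z`,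
`∏_{w ≤ p < z, p ≥ 3} (1 − g(p))⁻¹ ≤ (Π(z)/Π(w)) · exp(2/(max(w,3) − 2))`, `Π(y) = ∏_{p<y}(1 − 1/p)⁻¹`.
[cite: Nathanson1996, §10.3 (9.34)] -/
theorem prod_inv_one_sub_shiftedPrimesDensity_le {N : ℕ} (hN : Even N) {w z : ℝ} (hwz : w ≤ z) :
    ∏ p ∈ (Nat.primesBelow ⌈z⌉₊).filter (fun p : ℕ => w ≤ (p : ℝ)),
        (1 - shiftedPrimesDensity N p)⁻¹ ≤
      mertensProd z / mertensProd w * Real.exp (2 / (max w 3 - 2)) := by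
  set S := (Nat.primesBelow ⌈z⌉₊).filter (fun p : ℕ => w ≤ (p : ℝ)) with hS
  -- split off the prime `2` (factor `1`) : restrict to `p ≥ 3`, i.e. `max w 3 ≤ p`
  set S₃ := (Nat.primesBelow ⌈z⌉₊).filter (fun p : ℕ => max w 3 ≤ (p : ℝ)) with hS₃
  have hS₃S : S₃ ⊆ S := fun p hp => by
    rw [hS₃, Finset.mem_filter] at hp
    rw [hS, Finset.mem_filter]
    exact ⟨hp.1, le_trans (le_max_left _ _) hp.2⟩
  have hmem : ∀ p ∈ S, p.Prime ∧ w ≤ (p : ℝ) := fun p hp => by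
    rw [hS, Finset.mem_filter, Nat.mem_primesBelow] at hp
    exact ⟨hp.1.2, hp.2⟩
  have hfac1 : ∀ p ∈ S, 1 ≤ (1 - shiftedPrimesDensity N p)⁻¹ := fun p hp => by
    obtain ⟨h0, h12⟩ := shiftedPrimesDensity_prime_mem_Icc hN (hmem p hp).1
    exact one_le_inv_iff₀.mpr ⟨by linarith, by linarith⟩
  -- the factors outside `S₃` are `p = 2` (if present), where the factor is `1`
  have hout : ∀ p ∈ S, p ∉ S₃ → (1 - shiftedPrimesDensity N p)⁻¹ = 1 := fun p hpS hp3 => by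
    have hp := hmem p hpS
    have hp2 : p = 2 := by
      by_contra hne
      have h3 : 3 ≤ p := lt_of_le_of_ne hp.1.two_le (Ne.symm hne)
      refine hp3 ?_
      rw [hS₃, Finset.mem_filter]
      rw [hS, Finset.mem_filter] at hpS
      refine ⟨hpS.1, max_le hp.2 (by exact_mod_cast h3)⟩
    subst hp2
    rw [((shiftedPrimesDensity_prime_of_even hN Nat.prime_two).2 (even_iff_two_dvd.mp hN)),
      sub_zero, inv_one]
  have hsplit : ∏ p ∈ S, (1 - shiftedPrimesDensity N p)⁻¹ =
      ∏ p ∈ S₃, (1 - shiftedPrimesDensity N p)⁻¹ := by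
    rw [← Finset.prod_subset hS₃S fun p hp hp3 => hout p hp hp3]
  rw [hsplit]
  have hmem₃ : ∀ p ∈ S₃, p.Prime ∧ 3 ≤ p ∧ w ≤ (p : ℝ) := fun p hp => by
    rw [hS₃, Finset.mem_filter, Nat.mem_primesBelow] at hp
    have h3 : (3 : ℝ) ≤ p := le_trans (le_max_right _ _) hp.2
    exact ⟨hp.1.2, by exact_mod_cast h3, le_trans (le_max_left _ _) hp.2⟩
  -- pointwise bound and the two products
  have hle : ∏ p ∈ S₃, (1 - shiftedPrimesDensity N p)⁻¹ ≤
      (∏ p ∈ S₃, (1 - (p : ℝ)⁻¹)⁻¹) * ∏ p ∈ S₃, (1 + 1 / ((p : ℝ) * ((p : ℝ) - 2))) := by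
    rw [← Finset.prod_mul_distrib]
    refine Finset.prod_le_prod (fun p hp => ?_) fun p hp => ?_
    · obtain ⟨h0, h12⟩ := shiftedPrimesDensity_prime_mem_Icc hN (hmem₃ p hp).1
      exact inv_nonneg.mpr (by linarith)
    · exact inv_one_sub_shiftedPrimesDensity_le hN (hmem₃ p hp).1 (hmem₃ p hp).2.1
  refine hle.trans ?_
  have hw3 : max w 3 ≤ z ∨ z < max w 3 := le_or_gt _ _
  have h3 : (3 : ℝ) ≤ max w 3 := le_max_right _ _
  -- second product
  have h2nd : ∏ p ∈ S₃, (1 + 1 / ((p : ℝ) * ((p : ℝ) - 2))) ≤ Real.exp (2 / (max w 3 - 2)) :=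
    Chen.prod_one_add_inv_mul_sub_two_le h3
  -- first product: `Π(z)/Π(max w 3) ≤ Π(z)/Π(w)`
  have h1st : ∏ p ∈ S₃, (1 - (p : ℝ)⁻¹)⁻¹ ≤ mertensProd z / mertensProd w := by
    have hge1 : ∀ p ∈ S, 1 ≤ (1 - (p : ℝ)⁻¹)⁻¹ := fun p hp => by
      have hp2 : (2 : ℝ) ≤ p := by exact_mod_cast (hmem p hp).1.two_le
      have : (p : ℝ)⁻¹ ≤ 1 / 2 := by rw [inv_eq_one_div]; gcongr
      have h0 : 0 < (p : ℝ)⁻¹ := by positivity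
      exact one_le_inv_iff₀.mpr ⟨by linarith, by linarith⟩
    have hsub : ∏ p ∈ S₃, (1 - (p : ℝ)⁻¹)⁻¹ ≤ ∏ p ∈ S, (1 - (p : ℝ)⁻¹)⁻¹ := by
      rw [← Finset.prod_sdiff hS₃S]
      refine le_mul_of_one_le_left (Finset.prod_nonneg fun p hp => ?_)
        (Finset.one_le_prod fun p hp => hge1 p (Finset.sdiff_subset hp))
      exact zero_le_one.trans (hge1 p (hS₃S hp))
    refine hsub.trans_eq ?_
    rw [hS, prod_filter_eq_mertensProd_div hwz]
  have hA : 0 ≤ mertensProd z / mertensProd w :=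
    div_nonneg (mertensProd_pos z).le (mertensProd_pos w).le
  have hB : 0 ≤ ∏ p ∈ S₃, (1 + 1 / ((p : ℝ) * ((p : ℝ) - 2))) :=
    Finset.prod_nonneg fun p hp => by
      have : (3 : ℝ) ≤ p := by exact_mod_cast (hmem₃ p hp).2.1
      have : 0 ≤ 1 / ((p : ℝ) * ((p : ℝ) - 2)) := div_nonneg zero_le_one (by nlinarith)
      linarith
  exact mul_le_mul h1st h2nd hB hA

/-- **The Chen/Goldbach density has linear dimension `Ω(1, L₀)`, uniformly in even `N`**
(Nathanson §10.3, verification of (9.34) from Mertens' Thm 6.8; here with the absolute constant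
`L₀ = 54 e^{54/log 2}`): for even `N` and all `2 ≤ w ≤ z`,
`∏_{w ≤ p < z} (1 − g(p))⁻¹ ≤ (log z/log w)(1 + L₀/log w)`, `g = shiftedPrimesDensity N`.
[cite: Nathanson1996, §10.3 (9.33)–(9.34)] -/
theorem hasIwaniecDimension_shiftedPrimesDensity {N : ℕ} (hN : Even N) :
    HasIwaniecDimension (shiftedPrimesDensity N) 1 (54 * Real.exp (54 / Real.log 2)) := by
  refine ⟨fun p hp => ?_, fun w z hw hwz => ?_⟩
  · obtain ⟨h0, h12⟩ := shiftedPrimesDensity_prime_mem_Icc hN hp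
    exact ⟨h0, by linarith⟩
  have hlogw : 0 < Real.log w := Real.log_pos (by linarith)
  have hlogz : 0 < Real.log z := Real.log_pos (by linarith)
  have hlog2w : Real.log 2 ≤ Real.log w := Real.log_le_log two_pos hw
  have hlog2 : 0 < Real.log 2 := Real.log_pos one_lt_two
  have hl2 := Real.log_two_gt_d9
  have hl2' := Real.log_two_lt_d9
  refine (prod_inv_one_sub_shiftedPrimesDensity_le hN hwz).trans ?_
  -- `Π(z)/Π(w) ≤ (log z/log w) e^{50/log w}`
  set R := mertensProd z / mertensProd w with hR
  have hRpos : 0 < R := div_pos (mertensProd_pos z) (mertensProd_pos w)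
  obtain ⟨-, hz2⟩ := abs_le.mp (abs_log_mertensProd_sub_le (le_trans hw hwz))
  obtain ⟨hw1, -⟩ := abs_le.mp (abs_log_mertensProd_sub_le hw)
  have hlogR : Real.log R ≤ Real.log (Real.log z) - Real.log (Real.log w) + 50 / Real.log w := by
    rw [hR, Real.log_div (mertensProd_pos z).ne' (mertensProd_pos w).ne']
    have : 25 / Real.log z ≤ 25 / Real.log w :=
      div_le_div_of_nonneg_left (by norm_num) hlogw (Real.log_le_log (by linarith) hwz)
    have e50 : (50 : ℝ) / Real.log w = 2 * (25 / Real.log w) := by ring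
    linarith
  have hR1 : R ≤ Real.log z / Real.log w * Real.exp (50 / Real.log w) := by
    have e1 : R = Real.exp (Real.log R) := (Real.exp_log hRpos).symm
    have e2 : Real.log z / Real.log w * Real.exp (50 / Real.log w) =
        Real.exp (Real.log (Real.log z) - Real.log (Real.log w) + 50 / Real.log w) := by
      rw [Real.exp_add, Real.exp_sub, Real.exp_log hlogz, Real.exp_log hlogw]
    rw [e1, e2, Real.exp_le_exp]
    exact hlogR
  -- `2/(max w 3 - 2) ≤ 4/log w`
  have h2 : 2 / (max w 3 - 2) ≤ 4 / Real.log w := by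
    rcases le_or_gt 3 w with hw3 | hw3
    · rw [max_eq_left hw3]
      -- `log w ≤ w - 1 ≤ 2 (w - 2)` for `w ≥ 3`
      have hlw : Real.log w ≤ w - 1 := Real.log_le_sub_one_of_pos (by linarith)
      rw [div_le_div_iff₀ (by linarith) hlogw]
      nlinarith
    · rw [max_eq_right hw3.le]
      norm_num
      -- `log w < log 3 ≤ 2·?`: `log w ≤ log 4 = 2 log 2 < 2`, so `2 ≤ 4 / log w`
      have hlogw3 : Real.log w < 2 := by
        calc Real.log w < Real.log 4 := Real.log_lt_log (by linarith) (by linarith)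
          _ = 2 * Real.log 2 := by
              rw [show (4 : ℝ) = 2 ^ 2 by norm_num, Real.log_pow]; norm_num
          _ < 2 := by linarith
      rw [le_div_iff₀ hlogw]
      linarith
  have hexp2 : Real.exp (2 / (max w 3 - 2)) ≤ Real.exp (4 / Real.log w) :=
    Real.exp_le_exp.mpr h2
  -- combine : total ≤ (log z/log w) e^{54/log w}
  set t := 54 / Real.log w with ht_def
  have ht0 : 0 ≤ t := by positivity
  have htle : t ≤ 54 / Real.log 2 := div_le_div_of_nonneg_left (by norm_num) hlog2 hlog2w
  have hq : 0 ≤ Real.log z / Real.log w := div_nonneg hlogz.le hlogw.le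
  calc R * Real.exp (2 / (max w 3 - 2))
      ≤ Real.log z / Real.log w * Real.exp (50 / Real.log w) * Real.exp (4 / Real.log w) :=
        mul_le_mul hR1 hexp2 (Real.exp_pos _).le (by positivity)
    _ = Real.log z / Real.log w * Real.exp t := by
        rw [mul_assoc, ← Real.exp_add, ht_def]; ring_nf
    _ ≤ Real.log z / Real.log w * (1 + t * Real.exp (54 / Real.log 2)) := by
        gcongr
        calc Real.exp t ≤ 1 + t * Real.exp t := exp_le_one_add_mul_exp t
          _ ≤ 1 + t * Real.exp (54 / Real.log 2) := by gcongr
    _ = (Real.log z / Real.log w) ^ (1 : ℝ) * (1 + 54 * Real.exp (54 / Real.log 2) / Real.log w) := by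
        rw [Real.rpow_one, ht_def]; ring

namespace Chen

/-! ### Comparison of `V(w)` and `V(z)` for `z ≤ w` -/

/-- Splitting Chen's product at `z ≤ w`:
`V(w) = V(z) · ∏_{z ≤ p < w, p ∤ N} (1 − 1/(p−1))`. [cite: Nathanson1996, (10.8)] -/
theorem sieveProduct_eq_mul_prod_filter (N : ℕ) {z w : ℝ} (hzw : z ≤ w) :
    sieveProduct N w = sieveProduct N z *
      ∏ p ∈ ((Nat.primesBelow ⌈w⌉₊).filter (fun p : ℕ => z ≤ (p : ℝ))).filter
          (fun p : ℕ => ¬p ∣ N), (1 - 1 / ((p : ℝ) - 1)) := by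
  unfold sieveProduct
  rw [Finset.prod_filter, Finset.prod_filter, Finset.prod_filter,
    Chen.prod_primesBelow_split hzw, Finset.prod_filter]

/-- The primes `p ≥ z` dividing `N ≠ 0`, `N ≤ z⁸`, `z > 1`, among any set of primes `≥ z`, are at
most `8` in number, and `∏ (1 − 1/p)⁻¹ ≤ (1 + 1/(z−1))⁸` over them. [cite: Nathanson1996, Thm 10.3 (proof)] -/
theorem prod_inv_one_sub_inv_le_pow_eight {N : ℕ} {z : ℝ} (hN0 : N ≠ 0) (hz : 2 ≤ z)
    (hNz : (N : ℝ) ≤ z ^ 8) {S : Finset ℕ} (hS : ∀ p ∈ S, p.Prime ∧ z ≤ (p : ℝ) ∧ p ∣ N) :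
    ∏ p ∈ S, (1 - (p : ℝ)⁻¹)⁻¹ ≤ (1 + 1 / (z - 1)) ^ 8 := by
  have hSN : S ⊆ N.primeFactors := fun p hp =>
    Nat.mem_primeFactors.mpr ⟨(hS p hp).1, (hS p hp).2.2, hN0⟩
  have hcard : S.card ≤ 8 :=
    card_le_eight_of_prod_dvd hN0 (by linarith) hNz hSN fun p hp => (hS p hp).2.1
  have hfac : ∀ p ∈ S, 1 ≤ (1 - (p : ℝ)⁻¹)⁻¹ ∧ (1 - (p : ℝ)⁻¹)⁻¹ ≤ 1 + 1 / (z - 1) := by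
    intro p hp
    have hzp : z ≤ (p : ℝ) := (hS p hp).2.1
    have hp1 : (0 : ℝ) < (p : ℝ) - 1 := by linarith
    have hp0 : (p : ℝ) ≠ 0 := (by linarith : (0 : ℝ) < p).ne'
    have hp1' : (p : ℝ) - 1 ≠ 0 := hp1.ne'
    have e : (1 - (p : ℝ)⁻¹)⁻¹ = 1 + 1 / ((p : ℝ) - 1) := by
      rw [show (1 : ℝ) - (p : ℝ)⁻¹ = ((p : ℝ) - 1) / p by field_simp, inv_div]
      field_simp
      ring
    rw [e]
    refine ⟨le_add_of_nonneg_right (by positivity), ?_⟩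
    gcongr 1 + ?_
    exact one_div_le_one_div_of_le (by linarith) (by linarith)
  calc ∏ p ∈ S, (1 - (p : ℝ)⁻¹)⁻¹ ≤ ∏ _p ∈ S, (1 + 1 / (z - 1)) :=
        Finset.prod_le_prod (fun p hp => zero_le_one.trans (hfac p hp).1) fun p hp => (hfac p hp).2
    _ = (1 + 1 / (z - 1)) ^ S.card := Finset.prod_const _
    _ ≤ (1 + 1 / (z - 1)) ^ 8 := by
        refine pow_le_pow_right₀ ?_ hcard
        have : 0 ≤ 1 / (z - 1) := by
          have : 0 < z - 1 := by linarith
          positivity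
        linarith

/-- **`V(w)/V(z)` for `z ≤ w`** (Nathanson, proof of Thm 10.6, p. 289: "`V(y)/V(z) = (log z/log y)
(1 + O(1/log N))`", from (10.3)): for even `N ≠ 0`, `2 ≤ z ≤ w`, `N ≤ z⁸`,
`V(w) ≤ V(z) · (log z/log w) · e^{50/log z} · (1 + 1/(z−1))⁸`. Indeed
`V(w)/V(z) = ∏_{z ≤ p < w, p ∤ N} (1 − 1/(p−1)) ≤ ∏_{z ≤ p < w, p ∤ N} (1 − 1/p)
= (Π(z)/Π(w)) ∏_{z ≤ p < w, p ∣ N} (1 − 1/p)⁻¹`, with at most `8` primes `p ≥ z` dividing `N` and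
Mertens' product theorem with rate (`abs_log_mertensProd_sub_le`) twice.
[cite: Nathanson1996, Thm 10.6 (proof, V(y)/V(z))] -/
theorem sieveProduct_le_mul_of_le {N : ℕ} (hN : Even N) (hN0 : N ≠ 0) {z w : ℝ} (hz : 2 ≤ z)
    (hzw : z ≤ w) (hNz : (N : ℝ) ≤ z ^ 8) :
    sieveProduct N w ≤ sieveProduct N z * (Real.log z / Real.log w * Real.exp (50 / Real.log z) *
      (1 + 1 / (z - 1)) ^ 8) := by
  rw [sieveProduct_eq_mul_prod_filter N hzw]
  have hVz : 0 ≤ sieveProduct N z := by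
    unfold sieveProduct
    refine Finset.prod_nonneg fun p hp => ?_
    rw [Finset.mem_filter, Nat.mem_primesBelow] at hp
    obtain ⟨h1, -⟩ := shiftedPrimesDensity_prime_of_even hN hp.1.2
    have hp3 : (3 : ℝ) ≤ p := by exact_mod_cast (h1 hp.2).2
    have : 1 / ((p : ℝ) - 1) ≤ 1 / 2 := by
      rw [div_le_div_iff₀ (by linarith) (by norm_num)]; linarith
    linarith
  refine mul_le_mul_of_nonneg_left ?_ hVz
  set S := (Nat.primesBelow ⌈w⌉₊).filter (fun p : ℕ => z ≤ (p : ℝ)) with hS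
  set S₁ := S.filter (fun p : ℕ => ¬p ∣ N) with hS₁
  set S₂ := S.filter (fun p : ℕ => p ∣ N) with hS₂
  have hmemS : ∀ p ∈ S, p.Prime ∧ z ≤ (p : ℝ) := fun p hp => by
    rw [hS, Finset.mem_filter, Nat.mem_primesBelow] at hp
    exact ⟨hp.1.2, hp.2⟩
  -- step 1 : `1 - 1/(p-1) ≤ 1 - 1/p`
  have h1 : ∏ p ∈ S₁, (1 - 1 / ((p : ℝ) - 1)) ≤ ∏ p ∈ S₁, (1 - (p : ℝ)⁻¹) := by
    refine Finset.prod_le_prod (fun p hp => ?_) fun p hp => ?_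
    · have hp' := hmemS p (Finset.mem_filter.mp hp).1
      have hp2 : (2 : ℝ) ≤ p := by exact_mod_cast hp'.1.two_le
      obtain ⟨h1, -⟩ := shiftedPrimesDensity_prime_of_even hN hp'.1
      have hp3 : (3 : ℝ) ≤ p := by exact_mod_cast (h1 (Finset.mem_filter.mp hp).2).2
      have : 1 / ((p : ℝ) - 1) ≤ 1 / 2 := by
        rw [div_le_div_iff₀ (by linarith) (by norm_num)]; linarith
      linarith
    · have hp := hmemS p (Finset.mem_filter.mp hp).1
      have hp2 : (2 : ℝ) ≤ p := by exact_mod_cast hp.1.two_le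
      rw [inv_eq_one_div]
      gcongr _ - ?_
      exact one_div_le_one_div_of_le (by linarith) (by linarith)
  refine h1.trans ?_
  -- step 2 : `∏_{S₁} (1-1/p) = (∏_S (1-1/p)⁻¹)⁻¹ · ∏_{S₂} (1-1/p)⁻¹`
  have hpos : ∀ p ∈ S, 0 < 1 - (p : ℝ)⁻¹ := fun p hp => by
    have hp2 : (2 : ℝ) ≤ p := by exact_mod_cast (hmemS p hp).1.two_le
    have : (p : ℝ)⁻¹ ≤ 1 / 2 := by rw [inv_eq_one_div]; gcongr
    linarith
  have hprodS : ∏ p ∈ S, (1 - (p : ℝ)⁻¹) = (∏ p ∈ S₁, (1 - (p : ℝ)⁻¹)) * ∏ p ∈ S₂, (1 - (p : ℝ)⁻¹) := by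
    rw [hS₁, hS₂, mul_comm, Finset.prod_filter_mul_prod_filter_not]
  have hS₂pos : 0 < ∏ p ∈ S₂, (1 - (p : ℝ)⁻¹) :=
    Finset.prod_pos fun p hp => hpos p (Finset.mem_filter.mp hp).1
  have heq : ∏ p ∈ S₁, (1 - (p : ℝ)⁻¹) =
      (∏ p ∈ S, (1 - (p : ℝ)⁻¹)⁻¹)⁻¹ * ∏ p ∈ S₂, (1 - (p : ℝ)⁻¹)⁻¹ := by
    rw [Finset.prod_inv_distrib, Finset.prod_inv_distrib, inv_inv, hprodS,
      mul_inv_cancel_right₀ hS₂pos.ne']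
  rw [heq, hS, prod_filter_eq_mertensProd_div hzw, inv_div]
  -- step 3 : Mertens twice and the `≤ 8` primes dividing `N`
  have hlogz : 0 < Real.log z := Real.log_pos (by linarith)
  have hlogw : 0 < Real.log w := Real.log_pos (by linarith)
  have hR : mertensProd z / mertensProd w ≤ Real.log z / Real.log w * Real.exp (50 / Real.log z) := by
    have hRpos : 0 < mertensProd z / mertensProd w := div_pos (mertensProd_pos z) (mertensProd_pos w)
    obtain ⟨hw1, -⟩ := abs_le.mp (abs_log_mertensProd_sub_le (le_trans hz hzw))
    obtain ⟨-, hz2⟩ := abs_le.mp (abs_log_mertensProd_sub_le hz)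
    have hlogR : Real.log (mertensProd z / mertensProd w) ≤
        Real.log (Real.log z) - Real.log (Real.log w) + 50 / Real.log z := by
      rw [Real.log_div (mertensProd_pos z).ne' (mertensProd_pos w).ne']
      have : 25 / Real.log w ≤ 25 / Real.log z :=
        div_le_div_of_nonneg_left (by norm_num) hlogz (Real.log_le_log (by linarith) hzw)
      have e50 : (50 : ℝ) / Real.log z = 2 * (25 / Real.log z) := by ring
      linarith
    have e1 : mertensProd z / mertensProd w = Real.exp (Real.log (mertensProd z / mertensProd w)) :=
      (Real.exp_log hRpos).symm
    have e2 : Real.log z / Real.log w * Real.exp (50 / Real.log z) =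
        Real.exp (Real.log (Real.log z) - Real.log (Real.log w) + 50 / Real.log z) := by
      rw [Real.exp_add, Real.exp_sub, Real.exp_log hlogz, Real.exp_log hlogw]
    rw [e1, e2, Real.exp_le_exp]
    exact hlogR
  have h8 : ∏ p ∈ S₂, (1 - (p : ℝ)⁻¹)⁻¹ ≤ (1 + 1 / (z - 1)) ^ 8 :=
    prod_inv_one_sub_inv_le_pow_eight hN0 hz hNz fun p hp => by
      have hp' := Finset.mem_filter.mp hp
      exact ⟨(hmemS p hp'.1).1, (hmemS p hp'.1).2, hp'.2⟩
  have hA : 0 ≤ Real.log z / Real.log w * Real.exp (50 / Real.log z) := by positivity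
  have hB : 0 ≤ ∏ p ∈ S₂, (1 - (p : ℝ)⁻¹)⁻¹ :=
    Finset.prod_nonneg fun p hp => (inv_pos.mpr (hpos p (Finset.mem_filter.mp hp).1)).le
  calc mertensProd z / mertensProd w * ∏ p ∈ S₂, (1 - (p : ℝ)⁻¹)⁻¹
      ≤ Real.log z / Real.log w * Real.exp (50 / Real.log z) * (1 + 1 / (z - 1)) ^ 8 :=
        mul_le_mul hR h8 hB hA
    _ = _ := by ring

end Chen

end Literature.NumberTheory.Sieve
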